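import Summits.Ventures.HSemireg.Pad4TowerDelta2Window

/-!
# Venture HSemireg — PAD-4 on 𝔅(μ₄): TWISTED WINDOWS — twists `g = (η, σ) ∈ (ℤ∕4)⁴ ⋊ S₄` acting on cells, the ONE-STEP identity
# `wch(w) = i^{texp η w}·wch(σ⁻¹·w)` on every g-invariant weighted design, MONODROMY VANISHING along word orbits, and the (A1) table of
# card W14c (2)'s clean cyclic twists by `decide`: Δ∘σ 656 ∕ 192, γ-root 842 ∕ 98, Δ²∘τ 96 ∕ 498, Δ∘τ 684 ∕ 182, Δ×C₃ 840 ∕ 66, Δ²×C₃ 640 ∕ 134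

HONEST FRAMING. Lean index of the computation cell `pub-hsemireg` (S4-PUSH, H2 door PAD-4), typed by the Ventures-side typer
`hodge-lit-semireg-typer-2` (g5; line of record stmt-HodgeConjecture-18881 `Cruxes/BlochSeedDiscOne/Lines/birth.lean` 814a6a70c14e831a,
stub `stub_rung_pad4_seedAt`, screen (H1) = the class condition (A1)). Thirteenth file of the KERNEL LEMMA Ψ ⊂ (A1) set; sequel of (G)
`Pad4TowerPermWindow` (`MCell.perm`, `permW`, `ch_perm`), (H) `Pad4TowerPhaseTorus` (`MCell.phase`, `twistT`, `ch_phase`, the clean subgroups of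
the torus `T`) and (I) `Pad4TowerDelta2Window` (phase-invariant vanishing; the pure windows `⟨Δ⟩`, `⟨γ_j⟩` 840 ∕ 198 and `⟨Δ²⟩` 640 ∕ 398).
SOURCE SENTENCE (bc5-plan g6 IDEATOR LINE 3 «THE CLEAN-WINDOW ATLAS», cell INBOX l.31806; card `birth-v4.md` v4.16 row W14c (2); script
`twisted_windows.py` 23c0c9c374458df7, cell work∕g6∕): «TWISTS g = (ζ, π) ∈ T ⋊ S₄ … clean cyclic twists collapse to — 4-cycle: pure only
(no (A1) gain); 3-cycle: pure ∕ Δ×C₃ (order 12; 840 vanish, 66 independent survivors; ÷12) ∕ Δ²×C₃ (order 6; 640 ∕ 134; ÷6); double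
transposition σ: pure ∕ Δ∘σ-type (c = (2,2), order 4, square Δ², outside the Δ- and γ-windows; 656 ∕ 192; ÷4) ∕ γ-root (c = (1,−1), order 8,
square γ; 842 ∕ 98; ÷8); transposition τ: pure ∕ Δ²∘τ-type (order 2; 96 ∕ 498; ÷2) ∕ Δ∘τ-type (e.g. ((i,i,i,i),(34)), order 4, square Δ²,
outside the Δ-window; 684 ∕ 182; ÷4)». THIS FILE types the MECHANISM behind every entry and re-derives the six twisted number pairs in the
kernel: a weighted design invariant under `g = (η, σ)` (support g-closed, multiplicities g-invariant) has `wch(w) = i^{texp η w} · wch(σ⁻¹·w)`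
for every word (reindexing + `ch_twist`), hence along the `σ⁻¹`-orbit of a word the rows are proportional by units and `wch(w) = 0` as soon as
the orbit MONODROMY `i^{Σ texp}` is non-trivial — «vanish identically» = non-trivial monodromy (first number), «independent survivors» =
orbits of trivial monodromy (second number). These are the (A1)-side row reductions an encoder of the corresponding symmetric sub-cell
quotients by (bc5-plan's menu (a)∕(b): the cells Δ∘σ, Δ∘τ, Δ²∘τ, γ-root outside the Δ-window; Δ×C₃ at ◇₈ inside it).

CONTENT (all PROVED; no `sorry`; axioms standard).
* §1 `MCell.twist η σ` (permute by `σ`, then phase by `η`), **`MCell.ch_twist`**, `twist_injective`, **`MCell.twist_twist`** (the semidirect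
  law `(η',σ')·(η,σ) = (η' + σ'·η, σσ')`), `TwistClosed`, `image_twist_eq`, `sum_twist_reindex`, **`MConfig.wch_twist_step`** (the one-step
  identity, for every design and every `g`).
* §2 `monoE` (n-step monodromy exponent), **`MConfig.wch_twist_iter`**, **`MConfig.wch_eq_zero_of_monodromy`** (return after `n` steps with
  `monoE ≢ 0 (4)` ⇒ `wch(w) = 0`), **`MConfig.wch_eq_zero_iff_step`** (rows of one orbit stand or fall together).
* §3 the named twists: `sgA = (01)(23)`, `sgB = (23)`, `sgC = (012)`, `grVec = (1,0,3,0)`, word maps `omA ∕ omB ∕ omC` (= `permW σ⁻¹`, `om_spec`);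
  **`twist_squares`** ∕ **`MCell.twist_sq`** (`(Δ∘σ)² = Δ²`, `(γ-root)² = γ₁`, `(Δ²∘τ)² = 1`, `(Δ∘τ)² = Δ²`; cubes of `(Δ, c)`, `(Δ², c)` pure;
  `grVec ∈ T`); **`twist_clean`** (their pure parts `{0,Δ²}`, `⟨γ₁⟩`, `{0}`, `⟨Δ⟩`, `⟨Δ²⟩` are clean subgroups by (H) `cleanSub_six`; `Δ ∉ {0, Δ²}`,
  `Δ ∉ ⟨γ₁⟩`, `γ_j ∉ {0, Δ²}` — «outside the Δ- ∕ γ-windows»).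
* §4 THE TABLE by `decide` (`MixedW` = the 1038 (A1)(i) rows; `mono2` ∕ `mono3` = orbit monodromy for involutive ∕ 3-cycle twists; orbit
  representatives = `wcode`-minimal): `mixedW_count` 1038; **`table_deltaSigma` 656 ∕ 192; `table_gammaRoot` 842 ∕ 98; `table_delta2Tau` 96 ∕ 498;
  `table_deltaTau` 684 ∕ 182; `table_deltaC3` 840 ∕ 66; `table_delta2C3` 640 ∕ 134**; `table_pureC3` 0 ∕ 358.
* §5 design level: **`MConfig.wch_eq_zero_of_mono2`** ∕ **`_of_mono3`** (the table's criterion kills the row on every invariant design),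
  `MConfig.wch_eq_zero_of_deltaSigma_invariant`, `MConfig.wch_eq_zero_of_deltaC3_invariant`.
* §6 `twist_probe` (`decide`: `Δ∘σ` on a concrete cell — moved, square `Δ²`, order 4; the γ-root's fourth power is `Δ²`, order 8).

WHAT IS NOT HERE ∕ NOT IN LEAN. The EXHAUSTIVE classification («44 S₄-classes of clean cyclic twists collapse to exactly these types»; the
4-cycle case) is not re-derived — only the named representatives of the card are treated; conjugacy in `T ⋊ S₄`, the non-cyclic clean
windows `⟨Δ⟩×P`, `⟨γ⟩×P′`, Burnside ∕ instance counts (`÷4`, `÷8`, orbit-variable numbers), the §4 question to gs-eng-2 (does SAFE2∕E10 kill the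
twisted flips `Δ²∘τ`, `Δ∘σ`?), encoders and SAT verdicts: not here; nothing here is an object or a census row. The frame's identification with
`H^{ev}(S⁴)` and of the screen with PAD4-FIRSTORDER §0's (A1)-target stays the cell's pencil modelling sentence (as for 840 ∕ (F)). No variety,
sheaf, σ-field, seed or abelian variety; NOTHING HERE SAYS THAT HC ∕ HC_CM ∕ HC_AV ∕ W₆ ∕ HC_Kum4Type HOLDS OR FAILS. No `instance`, no notation,
no named fact, 0 `sorry`.

SOURCES (sha16 ∕ bus): bc5-plan g6 IDEATOR LINE 3 l.31806 + LINE 4 l.32037; card `birth-v4.md` v4.16 08c5ff260e40feb3 row W14c; `twisted_windows.py`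
23c0c9c374458df7 ∕ `torus_windows.py` aed8ecb1cabf8a65 (cell work∕g6∕; numbers re-derived here, not imported); (G) `Pad4TowerPermWindow.lean` p605333;
(H) `Pad4TowerPhaseTorus.lean` 69c8e5181a1acf05 p608476; (I) `Pad4TowerDelta2Window.lean` 0632296b53fe8b07 p610008. -/

namespace Summit.Ventures.HSemireg.Pad4Tower

open Finset

/-! ## §1 Twists `g = (η, σ) ∈ (ℤ∕4)⁴ ⋊ S₄` on cells, their composition, and the ONE-STEP identity on g-invariant designs -/

/-- the TWIST of a cell by `g = (η, σ)`: permute the factors by `σ` (`MCell.perm`), then turn the phases by `η` (`MCell.phase`). -/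
def MCell.twist (η : PVec) (σ : Equiv.Perm (Fin 4)) (Z : MCell) : MCell := (Z.perm σ).phase η

/-- the class tensor of a twisted cell: `ch(g·Z)(w) = i^{texp η w} · ch(Z)(σ⁻¹·w)` (`ch_phase` after `ch_perm`). -/
theorem MCell.ch_twist (η : PVec) (σ : Equiv.Perm (Fin 4)) (Z : MCell) (w : CWord) :
    (Z.twist η σ).ch w = twistT η w * Z.ch (permW σ⁻¹ w) := by
  rw [MCell.twist, MCell.ch_phase, MCell.ch_perm]

/-- twisting is injective. -/
theorem MCell.twist_injective (η : PVec) (σ : Equiv.Perm (Fin 4)) : Function.Injective (MCell.twist η σ) :=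
  (MCell.phase_injective η).comp (MCell.perm_injective σ)

/-- **COMPOSITION OF TWISTS** (the semidirect product law): `(η', σ')·((η, σ)·Z) = (η' + σ'·η, σσ')·Z`. -/
theorem MCell.twist_twist (η η' : PVec) (σ σ' : Equiv.Perm (Fin 4)) (Z : MCell) :
    (Z.twist η σ).twist η' σ' = Z.twist (η' + permP σ' η) (σ * σ') := by
  rw [MCell.twist, MCell.twist, MCell.twist, MCell.perm_phase, MCell.perm_mul, MCell.phase_add]

/-- a finite set of cells is CLOSED under the twist `g = (η, σ)`. -/
abbrev TwistClosed (η : PVec) (σ : Equiv.Perm (Fin 4)) (S : Finset MCell) : Prop := ∀ Z ∈ S, Z.twist η σ ∈ S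

/-- on a g-closed finite set g acts as a permutation. -/
theorem image_twist_eq (η : PVec) (σ : Equiv.Perm (Fin 4)) (S : Finset MCell) (hS : TwistClosed η σ S) :
    S.image (MCell.twist η σ) = S := by
  apply Finset.eq_of_subset_of_card_le
  · intro x hx
    obtain ⟨Z, hZ, rfl⟩ := Finset.mem_image.1 hx
    exact hS Z hZ
  · rw [Finset.card_image_of_injective _ (MCell.twist_injective η σ)]

/-- REINDEXING by g on a g-closed set. -/
theorem sum_twist_reindex {M : Type*} [AddCommMonoid M] (η : PVec) (σ : Equiv.Perm (Fin 4)) (S : Finset MCell)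
    (hS : TwistClosed η σ S) (g : MCell → M) : ∑ Z ∈ S, g (Z.twist η σ) = ∑ Z ∈ S, g Z := by
  conv_rhs => rw [← image_twist_eq η σ S hS]
  rw [Finset.sum_image fun Z _ Z' _ h => MCell.twist_injective η σ h]

/-- **THE ONE-STEP IDENTITY**: on a g-closed support with g-invariant weights, `wch(w) = i^{texp η w} · wch(σ⁻¹·w)` for EVERY word —
for every weighted design ((A1) or not) and every `g ∈ (ℤ∕4)⁴ ⋊ S₄` (the pure case `σ = 1` is (I) `wch_eq_zero_of_phaseInvariant`,
the phase-free case `η = 0` is (G) `wch_permW_of_permInvariant`). -/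
theorem MConfig.wch_twist_step (η : PVec) (σ : Equiv.Perm (Fin 4)) (C : MConfig) (hl : TwistClosed η σ C.lower)
    (hu : TwistClosed η σ C.upper) (mN mP : MCell → ℤ) (hN : ∀ Z, mN (Z.twist η σ) = mN Z) (hP : ∀ P, mP (P.twist η σ) = mP P)
    (w : CWord) : C.wch mN mP w = twistT η w * C.wch mN mP (permW σ⁻¹ w) := by
  have key : ∀ (S : Finset MCell), TwistClosed η σ S → ∀ m : MCell → ℤ, (∀ Z, m (Z.twist η σ) = m Z) →
      (∑ Z ∈ S, m Z • Z.ch) w = twistT η w * (∑ Z ∈ S, m Z • Z.ch) (permW σ⁻¹ w) := by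
    intro S hS m hm
    have r := sum_twist_reindex η σ S hS (fun Z => m Z • Z.ch)
    simp only [hm] at r
    conv_lhs => rw [← r]
    simp only [Finset.sum_apply, Pi.smul_apply]
    simp only [zsmul_eq_mul, MCell.ch_twist, Finset.mul_sum]
    exact Finset.sum_congr rfl fun Z _ => by ring
  have e : ∀ v, C.wch mN mP v = (∑ Z ∈ C.lower, mN Z • Z.ch) v - (∑ P ∈ C.upper, mP P • P.ch) v := fun v => by
    simp only [MConfig.wch, Pi.sub_apply]
  rw [e, e, mul_sub, ← key C.lower hl mN hN, ← key C.upper hu mP hP]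

/-! ## §2 Monodromy along the word orbit: vanishing and identification of rows on g-invariant designs -/

/-- the MONODROMY EXPONENT of `n` steps from the word `w`: `Σ_{j<n} texp η ((σ⁻¹·)^j w)`. -/
def monoE (η : PVec) (σ : Equiv.Perm (Fin 4)) : ℕ → CWord → ℕ
  | 0, _ => 0
  | n + 1, w => texp η w + monoE η σ n (permW σ⁻¹ w)

/-- `n` STEPS: `wch(w) = i^{monoE n w} · wch((σ⁻¹·)^n w)`. -/
theorem MConfig.wch_twist_iter (η : PVec) (σ : Equiv.Perm (Fin 4)) (C : MConfig) (hl : TwistClosed η σ C.lower)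
    (hu : TwistClosed η σ C.upper) (mN mP : MCell → ℤ) (hN : ∀ Z, mN (Z.twist η σ) = mN Z) (hP : ∀ P, mP (P.twist η σ) = mP P)
    (n : ℕ) : ∀ w : CWord, C.wch mN mP w = gI ^ monoE η σ n w * C.wch mN mP ((permW σ⁻¹)^[n] w) := by
  induction n with
  | zero => intro w; simp [monoE]
  | succ n ih =>
    intro w
    rw [C.wch_twist_step η σ hl hu mN mP hN hP w, ih (permW σ⁻¹ w), monoE, pow_add, twistT,
      Function.iterate_succ_apply]
    ring

/-- **MONODROMY VANISHING**: if the word returns after `n` steps (`(σ⁻¹·)^n w = w`) with monodromy `i^{monoE n w} ≠ 1`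
(`monoE ≢ 0 mod 4`), then `wch(w) = 0` on every g-invariant weighted design — the rows that «vanish identically» on the g-window. -/
theorem MConfig.wch_eq_zero_of_monodromy (η : PVec) (σ : Equiv.Perm (Fin 4)) (C : MConfig) (hl : TwistClosed η σ C.lower)
    (hu : TwistClosed η σ C.upper) (mN mP : MCell → ℤ) (hN : ∀ Z, mN (Z.twist η σ) = mN Z) (hP : ∀ P, mP (P.twist η σ) = mP P)
    (n : ℕ) (w : CWord) (hfix : (permW σ⁻¹)^[n] w = w) (hm : monoE η σ n w % 4 ≠ 0) : C.wch mN mP w = 0 := by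
  have h := C.wch_twist_iter η σ hl hu mN mP hN hP n w
  rw [hfix] at h
  have h1 : (gI ^ monoE η σ n w - 1) * C.wch mN mP w = 0 := by linear_combination (-1 : GaussianInt) * h
  rcases mul_eq_zero.1 h1 with h2 | h2
  · exact absurd ((gI_pow_eq_one_iff _).1 (sub_eq_zero.1 h2)) hm
  · exact h2

/-- **ROW IDENTIFICATION ALONG AN ORBIT**: on a g-invariant design `wch(w) = 0 ↔ wch(σ⁻¹·w) = 0` (the twist is a unit), so the (A1)
rows of one word orbit stand or fall together — the surviving rows count PER ORBIT («independent survivors»). -/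
theorem MConfig.wch_eq_zero_iff_step (η : PVec) (σ : Equiv.Perm (Fin 4)) (C : MConfig) (hl : TwistClosed η σ C.lower)
    (hu : TwistClosed η σ C.upper) (mN mP : MCell → ℤ) (hN : ∀ Z, mN (Z.twist η σ) = mN Z) (hP : ∀ P, mP (P.twist η σ) = mP P)
    (w : CWord) : C.wch mN mP w = 0 ↔ C.wch mN mP (permW σ⁻¹ w) = 0 := by
  rw [C.wch_twist_step η σ hl hu mN mP hN hP w, mul_eq_zero, twistT, or_iff_right]
  exact pow_ne_zero _ (by decide)

/-! ## §3 The clean cyclic twists of card W14c (2): Δ∘σ, the γ-root, Δ²∘τ, Δ∘τ (involutive σ) and Δ×C₃, Δ²×C₃ (3-cycles) -/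

/-- the double transposition `σ = (01)(23)`. -/
def sgA : Equiv.Perm (Fin 4) := Equiv.swap 0 1 * Equiv.swap 2 3

/-- the transposition `τ = (23)`. -/
def sgB : Equiv.Perm (Fin 4) := Equiv.swap 2 3

/-- the 3-cycle `c = (012)` (`= (02)(01)`: `0 ↦ 1 ↦ 2 ↦ 0`). -/
def sgC : Equiv.Perm (Fin 4) := Equiv.swap 0 2 * Equiv.swap 0 1

/-- the γ-ROOT phase vector `(1, 0, 3, 0)` (cycle sums `(1, −1)` on `(01)(23)`). -/
def grVec : PVec := pv 1 0 3 0

/-- the word map `σ_A⁻¹·` of the double transposition, written out. -/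
def omA (w : CWord) : CWord := ![w 1, w 0, w 3, w 2]

/-- the word map `σ_B⁻¹·` of the transposition, written out. -/
def omB (w : CWord) : CWord := ![w 0, w 1, w 3, w 2]

/-- the word map `σ_C⁻¹·` of the 3-cycle, written out. -/
def omC (w : CWord) : CWord := ![w 2, w 0, w 1, w 3]

/-- the written-out word maps ARE `permW σ⁻¹`; `σ_A, σ_B` are involutions, `σ_C` has order 3. [kernel, `decide`] -/
theorem om_spec : (∀ w, permW sgA⁻¹ w = omA w) ∧ (∀ w, permW sgB⁻¹ w = omB w) ∧ (∀ w, permW sgC⁻¹ w = omC w) ∧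
    sgA * sgA = 1 ∧ sgB * sgB = 1 ∧ sgC * sgC * sgC = 1 ∧ sgC ≠ 1 ∧ (∀ w, omA (omA w) = w) ∧ (∀ w, omB (omB w) = w) ∧
    ∀ w, omC (omC (omC w)) = w := by
  refine ⟨fun w => ?_, fun w => ?_, fun w => ?_, by decide, by decide, by decide, by decide, fun w => ?_, fun w => ?_, fun w => ?_⟩
  · funext f; fin_cases f <;> rfl
  · funext f; fin_cases f <;> rfl
  · funext f; fin_cases f <;> rfl
  · funext f; fin_cases f <;> rfl
  · funext f; fin_cases f <;> rfl
  · funext f; fin_cases f <;> rfl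

/-- **THE SQUARES** (composition law §1): `(Δ∘σ)² = Δ²`, `(γ-root)² = γ₁` (`gVec 0 = (1,1,3,3)`), `(Δ²∘τ)² = 1`, `(Δ∘τ)² = Δ²`; and the cube
of `(Δ², c)` is the pure `Δ²`, the cube of `(Δ, c)` the pure `Δ³` — as phase-vector identities `η + σ·η (+ σ²·η) = …` with `σ² = 1`
(resp. `c³ = 1`). [kernel, `decide`] -/
theorem twist_squares :
    dVec + permP sgA dVec = d2Vec ∧ grVec + permP sgA grVec = gVec 0 ∧ d2Vec + permP sgB d2Vec = 0 ∧ dVec + permP sgB dVec = d2Vec ∧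
      d2Vec + permP sgC d2Vec + permP (sgC * sgC) d2Vec = d2Vec ∧
      dVec + permP sgC dVec + permP (sgC * sgC) dVec = dVec + dVec + dVec ∧ DetOne grVec := by
  decide

/-- the squares as CELL MAPS: twisting twice by `Δ∘σ` or by `Δ∘τ` is `Δ²`, twice by the γ-root is `γ₁`, twice by `Δ²∘τ` is the identity. -/
theorem MCell.twist_sq (Z : MCell) :
    (Z.twist dVec sgA).twist dVec sgA = Z.delta2 ∧ (Z.twist grVec sgA).twist grVec sgA = Z.phase (gVec 0) ∧
      (Z.twist d2Vec sgB).twist d2Vec sgB = Z ∧ (Z.twist dVec sgB).twist dVec sgB = Z.delta2 := by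
  refine ⟨?_, ?_, ?_, ?_⟩ <;> rw [MCell.twist_twist]
  · rw [twist_squares.1, om_spec.2.2.2.1]; rfl
  · rw [twist_squares.2.1, om_spec.2.2.2.1]; rfl
  · rw [twist_squares.2.2.1, om_spec.2.2.2.2.1, MCell.twist, MCell.perm_one, MCell.phase_zero]
  · rw [twist_squares.2.2.2.1, om_spec.2.2.2.2.1]; rfl

/-- **CLEANLINESS** (card W14c: «clean window = no pure partial phase move»): the pure-phase parts of the four involutive twist groups
— `{0, Δ²}` for `Δ∘σ` and `Δ∘τ`, `⟨γ₁⟩` for the γ-root, `{0}` for `Δ²∘τ` — and of `Δ×C₃ ∕ Δ²×C₃` — `⟨Δ⟩`, `⟨Δ²⟩` — are CLEAN subgroups of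
the torus ((H) `cleanSub_six`), and NONE of the involutive four contains `Δ` itself («outside the Δ-window»: `Δ ∉ {0, Δ²}`, `Δ ∉ ⟨γ₁⟩`),
nor is the pure part of `Δ∘σ` a γ-group («outside the γ-windows»). [kernel, `decide` + (H)] -/
theorem twist_clean :
    CleanSub d2Sub ∧ CleanSub (gSub 0) ∧ CleanSub trivSub ∧ CleanSub dSub ∧ dVec ∉ d2Sub ∧ dVec ∉ gSub 0 ∧
      (∀ j : Fin 3, gVec j ∉ d2Sub) := by
  refine ⟨cleanSub_six.2.1, cleanSub_six.2.2.2 0, cleanSub_six.1, cleanSub_six.2.2.1, by decide, by decide, by decide⟩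

/-! ## §4 THE (A1) TABLE OF THE TWISTED WINDOWS: rows vanishing identically ∕ independent surviving rows (orbits), by `decide` -/

/-- a MIXED word: contains `e` or `ē` and is neither `eeee` nor `ēēēē` (the `1038` (A1)(i) rows). Decidable. -/
abbrev MixedW (w : CWord) : Prop := ¬ EFree w ∧ w ≠ eWord ∧ w ≠ ebarWord

/-- a code ordering the words (orbit representatives = code-minimal). -/
def wcode (w : CWord) : ℕ := 216 * (w 0).val + 36 * (w 1).val + 6 * (w 2).val + (w 3).val

/-- the ORBIT MONODROMY exponent of a mixed word under an involutive twist `(η, σ)` with word map `ω = σ⁻¹·`: `texp η w` on a fixed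
word, `texp η w + texp η (ω w)` on a 2-orbit. -/
def mono2 (η : PVec) (ω : CWord → CWord) (w : CWord) : ℕ := if ω w = w then texp η w else texp η w + texp η (ω w)

/-- the same under a twist whose permutation is a 3-cycle: orbits of length 1 or 3. -/
def mono3 (η : PVec) (ω : CWord → CWord) (w : CWord) : ℕ :=
  if ω w = w then texp η w else texp η w + texp η (ω w) + texp η (ω (ω w))

/-- the `1038` mixed words. [kernel, `decide`] -/
theorem mixedW_count : (univ.filter fun w : CWord => MixedW w).card = 1038 := by
  decide +kernel

/-- **THE TABLE, ROW `Δ∘σ`** (bc5-plan g6 IDEATOR LINE 3, card W14c (2), `twisted_windows.py` 23c0c9c374458df7 — here by `decide` in the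
kernel): among the `1038` mixed words, **656** have non-trivial orbit monodromy under `(Δ, (01)(23))` (rows VANISHING identically on every
invariant design, §2) and the words of trivial monodromy form **192** orbits (INDEPENDENT surviving rows). [kernel, `decide`] -/
theorem table_deltaSigma :
    (univ.filter fun w : CWord => MixedW w ∧ mono2 dVec omA w % 4 ≠ 0).card = 656 ∧
      (univ.filter fun w : CWord => MixedW w ∧ mono2 dVec omA w % 4 = 0 ∧ wcode w ≤ wcode (omA w)).card = 192 := by
  constructor <;> decide +kernel

/-- **ROW γ-ROOT** `((1,0,3,0), (01)(23))` (order 8, square `γ₁`): **842** vanish ∕ **98** independent survivors. [kernel, `decide`] -/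
theorem table_gammaRoot :
    (univ.filter fun w : CWord => MixedW w ∧ mono2 grVec omA w % 4 ≠ 0).card = 842 ∧
      (univ.filter fun w : CWord => MixedW w ∧ mono2 grVec omA w % 4 = 0 ∧ wcode w ≤ wcode (omA w)).card = 98 := by
  constructor <;> decide +kernel

/-- **ROW `Δ²∘τ`** `(Δ², (23))` (order 2): **96** vanish ∕ **498** independent survivors. [kernel, `decide`] -/
theorem table_delta2Tau :
    (univ.filter fun w : CWord => MixedW w ∧ mono2 d2Vec omB w % 4 ≠ 0).card = 96 ∧
      (univ.filter fun w : CWord => MixedW w ∧ mono2 d2Vec omB w % 4 = 0 ∧ wcode w ≤ wcode (omB w)).card = 498 := by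
  constructor <;> decide +kernel

/-- **ROW `Δ∘τ`** `(Δ, (23))` (order 4, square `Δ²`): **684** vanish ∕ **182** independent survivors. [kernel, `decide`] -/
theorem table_deltaTau :
    (univ.filter fun w : CWord => MixedW w ∧ mono2 dVec omB w % 4 ≠ 0).card = 684 ∧
      (univ.filter fun w : CWord => MixedW w ∧ mono2 dVec omB w % 4 = 0 ∧ wcode w ≤ wcode (omB w)).card = 182 := by
  constructor <;> decide +kernel

/-- **ROW `Δ×C₃`** (generator `(Δ, (012))`, order 12): **840** vanish ∕ **66** independent survivors. [kernel, `decide`] -/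
theorem table_deltaC3 :
    (univ.filter fun w : CWord => MixedW w ∧ mono3 dVec omC w % 4 ≠ 0).card = 840 ∧
      (univ.filter fun w : CWord => MixedW w ∧ mono3 dVec omC w % 4 = 0 ∧ wcode w ≤ wcode (omC w) ∧
        wcode w ≤ wcode (omC (omC w))).card = 66 := by
  constructor <;> decide +kernel

/-- **ROW `Δ²×C₃`** (generator `(Δ², (012))`, order 6): **640** vanish ∕ **134** independent survivors. [kernel, `decide`] -/
theorem table_delta2C3 :
    (univ.filter fun w : CWord => MixedW w ∧ mono3 d2Vec omC w % 4 ≠ 0).card = 640 ∧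
      (univ.filter fun w : CWord => MixedW w ∧ mono3 d2Vec omC w % 4 = 0 ∧ wcode w ≤ wcode (omC w) ∧
        wcode w ≤ wcode (omC (omC w))).card = 134 := by
  constructor <;> decide +kernel

/-- **ROW PURE 3-CYCLE** `(0, (012))`: **0** vanish ∕ **358** orbits («4-cycle ∕ 3-cycle pure: no (A1) gain» beyond the symmetry quotient).
For comparison (I): `⟨Δ⟩`, `⟨γ_j⟩` 840 ∕ 198; `⟨Δ²⟩` 640 ∕ 398. [kernel, `decide`] -/
theorem table_pureC3 :
    (univ.filter fun w : CWord => MixedW w ∧ mono3 0 omC w % 4 ≠ 0).card = 0 ∧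
      (univ.filter fun w : CWord => MixedW w ∧ mono3 0 omC w % 4 = 0 ∧ wcode w ≤ wcode (omC w) ∧
        wcode w ≤ wcode (omC (omC w))).card = 358 := by
  constructor <;> decide +kernel

/-! ## §5 From the table to designs: the orbit-monodromy criterion kills the row (instances of §2 at `n = 1, 2, 3`) -/

/-- **INVOLUTIVE TWISTS**: on a `(η, σ)`-invariant weighted design with `σ⁻¹·` an involution `ω` on words, every mixed word whose
2-orbit monodromy `mono2` is non-trivial has `wch(w) = 0` — so the table's first number (656 ∕ 842 ∕ 96 ∕ 684) counts rows that vanish on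
EVERY such design, (A1) or not. -/
theorem MConfig.wch_eq_zero_of_mono2 (η : PVec) (σ : Equiv.Perm (Fin 4)) (C : MConfig) (hl : TwistClosed η σ C.lower)
    (hu : TwistClosed η σ C.upper) (mN mP : MCell → ℤ) (hN : ∀ Z, mN (Z.twist η σ) = mN Z) (hP : ∀ P, mP (P.twist η σ) = mP P)
    (ω : CWord → CWord) (hω : ∀ w, permW σ⁻¹ w = ω w) (hinv : ∀ w, ω (ω w) = w) (w : CWord) (hm : mono2 η ω w % 4 ≠ 0) :
    C.wch mN mP w = 0 := by
  unfold mono2 at hm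
  by_cases hfix : ω w = w
  · rw [if_pos hfix] at hm
    exact C.wch_eq_zero_of_monodromy η σ hl hu mN mP hN hP 1 w (by simp [hω, hfix]) (by simpa [monoE] using hm)
  · rw [if_neg hfix] at hm
    exact C.wch_eq_zero_of_monodromy η σ hl hu mN mP hN hP 2 w (by simp [hω, hinv]) (by simpa [monoE, hω] using hm)

/-- **3-CYCLE TWISTS**: the same with `ω` of order 3 and the 3-orbit monodromy `mono3` (840 ∕ 640 ∕ 0 rows). -/
theorem MConfig.wch_eq_zero_of_mono3 (η : PVec) (σ : Equiv.Perm (Fin 4)) (C : MConfig) (hl : TwistClosed η σ C.lower)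
    (hu : TwistClosed η σ C.upper) (mN mP : MCell → ℤ) (hN : ∀ Z, mN (Z.twist η σ) = mN Z) (hP : ∀ P, mP (P.twist η σ) = mP P)
    (ω : CWord → CWord) (hω : ∀ w, permW σ⁻¹ w = ω w) (hinv : ∀ w, ω (ω (ω w)) = w) (w : CWord) (hm : mono3 η ω w % 4 ≠ 0) :
    C.wch mN mP w = 0 := by
  unfold mono3 at hm
  by_cases hfix : ω w = w
  · rw [if_pos hfix] at hm
    exact C.wch_eq_zero_of_monodromy η σ hl hu mN mP hN hP 1 w (by simp [hω, hfix]) (by simpa [monoE] using hm)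
  · rw [if_neg hfix] at hm
    exact C.wch_eq_zero_of_monodromy η σ hl hu mN mP hN hP 3 w (by simp [hω, hinv])
      (by simpa [monoE, hω, add_assoc] using hm)

/-- **THE `Δ∘σ` WINDOW AT DESIGN LEVEL**: on a `(Δ, (01)(23))`-invariant weighted design the 656 rows of `table_deltaSigma` vanish and the
rows of each word orbit stand or fall together; likewise for the other five twists with their `ω` (`om_spec`). -/
theorem MConfig.wch_eq_zero_of_deltaSigma_invariant (C : MConfig) (hl : TwistClosed dVec sgA C.lower) (hu : TwistClosed dVec sgA C.upper)
    (mN mP : MCell → ℤ) (hN : ∀ Z, mN (Z.twist dVec sgA) = mN Z) (hP : ∀ P, mP (P.twist dVec sgA) = mP P) (w : CWord) :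
    (mono2 dVec omA w % 4 ≠ 0 → C.wch mN mP w = 0) ∧ (C.wch mN mP w = 0 ↔ C.wch mN mP (omA w) = 0) :=
  ⟨C.wch_eq_zero_of_mono2 dVec sgA hl hu mN mP hN hP omA om_spec.1 om_spec.2.2.2.2.2.2.2.1 w,
    om_spec.1 w ▸ C.wch_eq_zero_iff_step dVec sgA hl hu mN mP hN hP w⟩

/-- the `Δ×C₃` window at design level (generator `(Δ, (012))`): the 840 rows of `table_deltaC3` vanish. -/
theorem MConfig.wch_eq_zero_of_deltaC3_invariant (C : MConfig) (hl : TwistClosed dVec sgC C.lower) (hu : TwistClosed dVec sgC C.upper)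
    (mN mP : MCell → ℤ) (hN : ∀ Z, mN (Z.twist dVec sgC) = mN Z) (hP : ∀ P, mP (P.twist dVec sgC) = mP P) (w : CWord)
    (hm : mono3 dVec omC w % 4 ≠ 0) : C.wch mN mP w = 0 :=
  C.wch_eq_zero_of_mono3 dVec sgC hl hu mN mP hN hP omC om_spec.2.2.1 om_spec.2.2.2.2.2.2.2.2.2 w hm

/-! ## §6 Probes (`decide` on closed terms) -/

/-- PROBE: on the cell `Z = [ℓ₁ | 2ℓ₁ | (3,0,0) | 0]` the twist `Δ∘σ` swaps factors `0 ↔ 1`, `2 ↔ 3` and turns every phase by `i`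
(`deltaPt`: `lpt c k ↦ lpt c (k−1)`, `β ↦ iβ`), giving `[lpt 2 3 | lpt 1 3 | 0 | (3,0,0)]`; it moves `Z`, its square is `Δ²Z ≠ Z` and its fourth power is `Z` (order exactly 4 on this cell);
the γ-root has order 8 on it (`g⁴ Z = Δ² Z ≠ Z`). -/
theorem twist_probe :
    let Z : MCell := ![lpt 1 0, lpt 2 0, (3, 0, 0), (0, 0, 0)]
    Z.twist dVec sgA ≠ Z ∧ (Z.twist dVec sgA).twist dVec sgA = Z.delta2 ∧ Z.delta2 ≠ Z ∧ Z.delta2.delta2 = Z ∧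
      (((Z.twist grVec sgA).twist grVec sgA).twist grVec sgA).twist grVec sgA = Z.delta2 ∧
      Z.twist dVec sgA = ![lpt 2 3, lpt 1 3, (0, 0, 0), (3, 0, 0)] := by
  refine ⟨by decide +kernel, (MCell.twist_sq _).1, by decide +kernel, MCell.delta2_delta2 _, ?_, by decide +kernel⟩
  rw [(MCell.twist_sq _).2.1, (MCell.twist_sq _).2.1]
  decide +kernel

end Summit.Ventures.HSemireg.Pad4Tower
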